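import Summits.CriticalPhenomena.SAWScalingLimit.Theorems.EdgeOfPositivity.Negative.EdgeOfPositivityBoxCertificates
import Literature.Probability.RandomPlanarGeometry.SAWStripPartitionFunction
import Literature.Probability.Percolation.PlanarDuality
import Literature.Probability.Percolation.SiteConnectionTools
import HarnessLib

/-!
# Rectangle plumbing — stub `stub_rectanglePlumbing` of line `rectangle-windows` (crux EdgeOfPositivity, stmt-CriticalPhenomena-11344)

A strict corner violation of TP₂ for the real box partition functions
`Zs[x, W, ℓ, a, b] = Σ_s x^s · #stripSAWs W ℓ s a b` of the lattice box `{0..ℓ} × {1..W}`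
(`W ≥ 2`, `ℓ ≥ 1`, `x > 0`) at the corners `TL = (0,W)`, `BL = (0,1)`, `BR = (ℓ,1)`, `TR = (ℓ,W)`,
in the form "nested < crossing", IS a witness of the crux body `Negative.EdgeOfPositivityAt x`.

The witness is the open rectangle `Ω = rectDomain ℓ (W-1) = (-1/2, ℓ+1/2) × (-1/2, W-1/2)` at mesh
`δ = 1`, whose discrete domain is the grid `{0..ℓ} × {0..W-1}` with lattice adjacency
(`Negative.adj_rect_iff`), i.e. the box shifted down by one row, with the shifted corners
`p₁ = (0,W-1)`, `p₂ = (0,0)`, `p₃ = (ℓ,0)`, `p₄ = (ℓ,W-1)`.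
* Transport (`Zx_rect_eq`): shifting a self-avoiding walk of `Ω_1` up by `e₂ = (0,1)` is a
  weight-preserving bijection onto the self-avoiding lattice walks confined to the box, so
  `Zx x Ω 1 u v = ENNReal.ofReal (Zs[x, W, ℓ, u + e₂, v + e₂])`; formally two injections compared by
  `ENNReal.tsum_comp_le_tsum_of_injective`, every property being read off the support equation
  `q.support = p.support.map (· + e₂)`.
* Interlacing of `(p₁p₃ | p₂p₄)`: a left–right and a bottom–top crossing of a rectangle meet
  (`Percolation.exists_mem_support_of_crossing`).
* The pairings `(p₁p₂ | p₃p₄)` and `(p₁p₄ | p₂p₃)` are realised by the two vertical, resp. the two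
  horizontal, sides of the grid: disjoint straight self-avoiding walks (`ℓ ≥ 1`, `W ≥ 2`).
* `ofReal a * ofReal b < ofReal c * ofReal d` from `a * b < c * d` and `0 ≤ a, b, c`.
Sources: folklore lattice combinatorics.
-/

noncomputable section

open Finset SimpleGraph
open Literature.Probability.LatticeModels Literature.Probability.RandomPlanarGeometry
open Literature.Probability.Percolation (exists_mem_support_of_crossing zdGraph_two_adj_iff)
open Summit.CriticalPhenomena.SAWScalingLimit.Theorems.EdgeOfPositivity.Negative
open scoped ENNReal

namespace Summit.CriticalPhenomena.SAWScalingLimit.Theorems.EdgeOfPositivity.RectangleWindows.RectanglePlumbing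

local notation3 (prettyPrint := false) "Zs[" x ", " n ", " ℓ ", " a ", " b "]" =>
  (∑ s ∈ Finset.range ((ℓ + 1) * n + 1), (x : ℝ) ^ s * ((SAW.stripSAWs n ℓ s a b).card : ℝ))

-- the finite set of self-avoiding lattice walks `u → v` confined to `{0..a} × {1..b+1}`
local notation3 (prettyPrint := false) "Abox[" a ", " b ", " u ", " v "]" =>
  ((Finset.range ((a + 1) * (b + 1) + 1)).biUnion fun s => SAW.stripSAWs (b + 1) a s u v)

/-! ## The grid graph `Ω_1` of the rectangle and the shift by `e₂` -/

/-- The grid graph `Ω_1` of the rectangle is a subgraph of `ℤ²`. [folklore] -/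
theorem rect_le_zdGraph (a b : ℕ) : discreteDomainGraph (rectDomain a b) 1 ≤ zdGraph 2 :=
  fun _ _ h => (adj_rect_iff.1 h).1

/-- Translating both endpoints by the same vector preserves lattice adjacency. [folklore] -/
theorem zdGraph_adj_add_iff (t x y : Site 2) :
    (zdGraph 2).Adj (x + t) (y + t) ↔ (zdGraph 2).Adj x y :=
  zdGraph_adj_shift_iff t x y

/-- The grid `{0..a} × {0..b}` shifted up by `e₂ = (0,1)` is the strip box `{0..a} × {1..b+1}`.
[folklore] -/
theorem mem_rectSites_iff_shift {a b : ℕ} {w : Site 2} :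
    w ∈ rectSites a b ↔ w + ![0, 1] ∈ SAW.stripBox (b + 1) a := by
  rw [mem_rectSites_iff, SAW.mem_stripBox]
  simp only [Pi.add_apply, Matrix.cons_val_zero, Matrix.cons_val_one, add_zero]
  push_cast
  omega

/-- Two walks (possibly in different graphs) whose supports correspond under a map have the same
length. [folklore] -/
theorem length_eq_of_support {V V' : Type*} {G : SimpleGraph V} {G' : SimpleGraph V'} {f : V → V'}
    {u v : V} {u' v' : V'} {p : G.Walk u v} {q : G'.Walk u' v'}
    (h : q.support = p.support.map f) : q.length = p.length := by
  have h' := congrArg List.length h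
  rw [List.length_map, Walk.length_support, Walk.length_support] at h'
  omega

/-- Two walks whose supports correspond under an injective map are simultaneously self-avoiding.
[folklore] -/
theorem isPath_iff_of_support {V V' : Type*} {G : SimpleGraph V} {G' : SimpleGraph V'} {f : V → V'}
    (hf : Function.Injective f) {u v : V} {u' v' : V'} {p : G.Walk u v} {q : G'.Walk u' v'}
    (h : q.support = p.support.map f) : q.IsPath ↔ p.IsPath := by
  rw [Walk.isPath_def, Walk.isPath_def, h, List.nodup_map_iff hf]

/-- UP: every walk of `Ω_1` shifted up by `e₂` is a lattice walk (with the shifted support).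
[folklore] -/
theorem exists_walk_shift_up {a b : ℕ} {u v : Site 2}
    (p : (discreteDomainGraph (rectDomain a b) 1).Walk u v) :
    ∃ q : (zdGraph 2).Walk (u + ![0, 1]) (v + ![0, 1]), q.support = p.support.map (· + ![0, 1]) := by
  induction p with
  | nil => exact ⟨Walk.nil, by simp⟩
  | cons h _ ih =>
    obtain ⟨q, hq⟩ := ih
    exact ⟨Walk.cons ((zdGraph_adj_add_iff _ _ _).2 (adj_rect_iff.1 h).1) q, by simp [hq]⟩

/-- DOWN: every lattice walk confined to the strip box `{0..a} × {1..b+1}`, shifted down by `e₂`,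
is a walk of `Ω_1` (lattice neighbours inside the grid are adjacent in `Ω_1`, `adj_rect_iff`).
[folklore] -/
theorem exists_walk_shift_down {a b : ℕ} {u' v' : Site 2} (q : (zdGraph 2).Walk u' v') :
    ∀ u v : Site 2, u + ![0, 1] = u' → v + ![0, 1] = v' →
      (∀ w ∈ q.support, w ∈ SAW.stripBox (b + 1) a) →
      ∃ p : (discreteDomainGraph (rectDomain a b) 1).Walk u v,
        q.support = p.support.map (· + ![0, 1]) := by
  induction q with
  | nil =>
    intro u v hu hv _
    obtain rfl : u = v := add_right_cancel (hu.trans hv.symm)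
    exact ⟨Walk.nil, by rw [Walk.support_nil, Walk.support_nil, List.map_singleton, hu]⟩
  | @cons x y z h q ih =>
    intro u v hu hv hbox
    have hx : x ∈ SAW.stripBox (b + 1) a := hbox x (Walk.start_mem_support _)
    have hy : y ∈ SAW.stripBox (b + 1) a :=
      hbox y (by rw [Walk.support_cons]; exact List.mem_cons_of_mem _ q.start_mem_support)
    obtain ⟨p, hp⟩ := ih (y - ![0, 1]) v (sub_add_cancel _ _) hv
      (fun w hw => hbox w (by rw [Walk.support_cons]; exact List.mem_cons_of_mem _ hw))
    have hu' : u ∈ rectSites a b := by rw [mem_rectSites_iff_shift, hu]; exact hx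
    have hy' : y - ![0, 1] ∈ rectSites a b := by rw [mem_rectSites_iff_shift, sub_add_cancel]; exact hy
    have hadj : (discreteDomainGraph (rectDomain a b) 1).Adj u (y - ![0, 1]) := by
      refine adj_rect_iff.2 ⟨?_, hu', hy'⟩
      rw [← zdGraph_adj_add_iff ![0, 1], hu, sub_add_cancel]
      exact h
    exact ⟨Walk.cons hadj p, by rw [Walk.support_cons, Walk.support_cons, List.map_cons, hu, hp]⟩

/-! ## Straight walks along the sides of the grid -/

/-- The straight walk DOWN column `i` of the grid, from row `k` to row `0`: a self-avoiding walk of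
`Ω_1` staying in column `i` and rows `0..k`. [folklore] -/
theorem exists_colWalk {a b : ℕ} {i : ℤ} (hi0 : 0 ≤ i) (hia : i ≤ a) :
    ∀ k : ℕ, k ≤ b → ∃ p : (discreteDomainGraph (rectDomain a b) 1).Walk ![i, (k : ℤ)] ![i, 0],
      p.IsPath ∧ ∀ w ∈ p.support, w 0 = i ∧ 0 ≤ w 1 ∧ w 1 ≤ k := by
  intro k
  induction k with
  | zero =>
    intro _
    rw [Nat.cast_zero]
    refine ⟨Walk.nil, Walk.IsPath.nil, fun w hw => ?_⟩
    rw [Walk.support_nil, List.mem_singleton] at hw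
    subst hw
    simp
  | succ k ih =>
    intro hk
    obtain ⟨p, hp, hsup⟩ := ih (Nat.le_of_succ_le hk)
    have hadj : (discreteDomainGraph (rectDomain a b) 1).Adj ![i, ((k + 1 : ℕ) : ℤ)] ![i, (k : ℤ)] := by
      refine adj_rect_iff.2 ⟨(zdGraph_two_adj_iff _ _).2 (Or.inr (Or.inr (Or.inr ⟨?_, ?_⟩))), ?_, ?_⟩
      · simp
      · simp
      · simp only [mem_rectSites_iff, Matrix.cons_val_zero, Matrix.cons_val_one]; omega
      · simp only [mem_rectSites_iff, Matrix.cons_val_zero, Matrix.cons_val_one]; omega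
    refine ⟨Walk.cons hadj p, (Walk.cons_isPath_iff hadj p).2 ⟨hp, fun hmem => ?_⟩, fun w hw => ?_⟩
    · have := (hsup _ hmem).2.2
      simp only [Matrix.cons_val_one, Matrix.cons_val_zero] at this
      omega
    · rw [Walk.support_cons, List.mem_cons] at hw
      rcases hw with rfl | hw
      · simp only [Matrix.cons_val_zero, Matrix.cons_val_one, true_and]; omega
      · obtain ⟨h0, h1, h2⟩ := hsup w hw
        exact ⟨h0, h1, by omega⟩

/-- The straight walk LEFT along row `j` of the grid, from column `k` to column `0`: a
self-avoiding walk of `Ω_1` staying in row `j` and columns `0..k`. [folklore] -/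
theorem exists_rowWalk {a b : ℕ} {j : ℤ} (hj0 : 0 ≤ j) (hjb : j ≤ b) :
    ∀ k : ℕ, k ≤ a → ∃ p : (discreteDomainGraph (rectDomain a b) 1).Walk ![(k : ℤ), j] ![0, j],
      p.IsPath ∧ ∀ w ∈ p.support, w 1 = j ∧ 0 ≤ w 0 ∧ w 0 ≤ k := by
  intro k
  induction k with
  | zero =>
    intro _
    rw [Nat.cast_zero]
    refine ⟨Walk.nil, Walk.IsPath.nil, fun w hw => ?_⟩
    rw [Walk.support_nil, List.mem_singleton] at hw
    subst hw
    simp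
  | succ k ih =>
    intro hk
    obtain ⟨p, hp, hsup⟩ := ih (Nat.le_of_succ_le hk)
    have hadj : (discreteDomainGraph (rectDomain a b) 1).Adj ![((k + 1 : ℕ) : ℤ), j] ![(k : ℤ), j] := by
      refine adj_rect_iff.2 ⟨(zdGraph_two_adj_iff _ _).2 (Or.inr (Or.inl ⟨?_, ?_⟩)), ?_, ?_⟩
      · simp
      · simp
      · simp only [mem_rectSites_iff, Matrix.cons_val_zero, Matrix.cons_val_one]; omega
      · simp only [mem_rectSites_iff, Matrix.cons_val_zero, Matrix.cons_val_one]; omega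
    refine ⟨Walk.cons hadj p, (Walk.cons_isPath_iff hadj p).2 ⟨hp, fun hmem => ?_⟩, fun w hw => ?_⟩
    · have := (hsup _ hmem).2.2
      simp only [Matrix.cons_val_zero] at this
      omega
    · rw [Walk.support_cons, List.mem_cons] at hw
      rcases hw with rfl | hw
      · simp only [Matrix.cons_val_zero, Matrix.cons_val_one, true_and]; omega
      · obtain ⟨h0, h1, h2⟩ := hsup w hw
        exact ⟨h0, h1, by omega⟩

/-! ## Transport: `Zx` on the grid is the real box sum -/

/-- Membership in the finite set of confined self-avoiding lattice walks: self-avoiding and inside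
the box (the length bound is automatic, `SAW.lt_of_mem_stripSAWs`). [folklore] -/
theorem mem_Abox {a b : ℕ} {u v : Site 2} {q : (zdGraph 2).Walk u v} :
    q ∈ Abox[a, b, u, v] ↔ q.IsPath ∧ ∀ w ∈ q.support, w ∈ SAW.stripBox (b + 1) a := by
  rw [Finset.mem_biUnion]
  constructor
  · rintro ⟨s, -, hs⟩
    exact (SAW.mem_stripSAWs.1 hs).2
  · rintro ⟨hq, hbox⟩
    have hmem : q ∈ SAW.stripSAWs (b + 1) a q.length u v := SAW.mem_stripSAWs.2 ⟨rfl, hq, hbox⟩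
    exact ⟨q.length, Finset.mem_range.2 (Nat.lt_succ_of_lt (SAW.lt_of_mem_stripSAWs hmem)), hmem⟩

/-- The real box sum, graded by length, is the sum of `x^{|q|}` over the confined self-avoiding
walks. [folklore] -/
theorem sum_Abox {a b : ℕ} (x : ℝ) (u v : Site 2) :
    ∑ q ∈ Abox[a, b, u, v], x ^ q.length =
      ∑ s ∈ Finset.range ((a + 1) * (b + 1) + 1), x ^ s * ((SAW.stripSAWs (b + 1) a s u v).card : ℝ) := by
  rw [Finset.sum_biUnion]
  · refine Finset.sum_congr rfl fun s _ => ?_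
    calc ∑ q ∈ SAW.stripSAWs (b + 1) a s u v, x ^ q.length
        = ∑ q ∈ SAW.stripSAWs (b + 1) a s u v, x ^ s :=
          Finset.sum_congr rfl fun q hq => by rw [(SAW.mem_stripSAWs.1 hq).1]
      _ = x ^ s * ((SAW.stripSAWs (b + 1) a s u v).card : ℝ) := by
          rw [Finset.sum_const, nsmul_eq_mul, mul_comm]
  · intro s _ t _ hst
    exact Finset.disjoint_left.2 fun q hqs hqt =>
      hst ((SAW.mem_stripSAWs.1 hqs).1.symm.trans (SAW.mem_stripSAWs.1 hqt).1)

/-- **Transport.** For a grid site `u`, the fugacity-`x` partition function of `Ω_1` between `u` and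
`v` is the real box sum between the shifted sites `u + e₂`, `v + e₂` of the box `{0..a} × {1..b+1}`:
the shift by `e₂` is a weight-preserving bijection between self-avoiding walks of `Ω_1` and confined
self-avoiding lattice walks (here: two weight-preserving injections). [folklore] -/
theorem Zx_rect_eq {a b : ℕ} {x : ℝ} (hx : 0 ≤ x) {u v u' v' : Site 2} (hu : u ∈ rectSites a b)
    (hu' : u' = u + ![0, 1]) (hv' : v' = v + ![0, 1]) :
    Zx x (rectDomain a b) 1 u v =
      ENNReal.ofReal (∑ s ∈ Finset.range ((a + 1) * (b + 1) + 1),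
        x ^ s * ((SAW.stripSAWs (b + 1) a s u' v').card : ℝ)) := by
  subst hu' hv'
  -- UP: self-avoiding walks of `Ω_1` inject into the finset `A` of confined lattice SAWs
  have hF1 : ∀ γ : SAW.DomainSAW (rectDomain a b) 1 u v,
      ∃ q : ↥(Abox[a, b, u + ![0, 1], v + ![0, 1]]), q.1.support = γ.walk.support.map (· + ![0, 1]) := by
    intro γ
    obtain ⟨q, hq⟩ := exists_walk_shift_up γ.walk
    refine ⟨⟨q, ?_⟩, hq⟩
    rw [mem_Abox]
    refine ⟨(isPath_iff_of_support (add_left_injective _) hq).2 γ.isPath, fun w hw => ?_⟩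
    rw [hq, List.mem_map] at hw
    obtain ⟨w₀, hw₀, rfl⟩ := hw
    exact mem_rectSites_iff_shift.1 (support_subset_rectSites hu γ.walk w₀ hw₀)
  choose f hf using hF1
  have hf_inj : Function.Injective f := by
    intro γ₁ γ₂ h
    have h' : γ₁.walk.support.map (· + ![0, 1]) = γ₂.walk.support.map (· + ![0, 1]) := by
      rw [← hf γ₁, ← hf γ₂, h]
    exact support_injective ((List.map_injective_iff.2 (add_left_injective _)) h')
  -- DOWN: `A` injects into the self-avoiding walks of `Ω_1`
  have hF2 : ∀ q : ↥(Abox[a, b, u + ![0, 1], v + ![0, 1]]), ∃ γ : SAW.DomainSAW (rectDomain a b) 1 u v,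
      q.1.support = γ.walk.support.map (· + ![0, 1]) := by
    intro q
    have hq := mem_Abox.1 q.2
    obtain ⟨p, hp⟩ := exists_walk_shift_down q.1 u v rfl rfl hq.2
    exact ⟨⟨p, (isPath_iff_of_support (add_left_injective _) hp).1 hq.1⟩, hp⟩
  choose g hg using hF2
  have hg_inj : Function.Injective g := by
    intro q₁ q₂ h
    have h' : q₁.1.support = q₂.1.support := by rw [hg q₁, hg q₂, h]
    exact Subtype.ext (Walk.ext_support h')
  -- the finite sum over `A`
  have hsum : ∑ q ∈ Abox[a, b, u + ![0, 1], v + ![0, 1]], ENNReal.ofReal (x ^ q.length) =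
      ENNReal.ofReal (∑ s ∈ Finset.range ((a + 1) * (b + 1) + 1),
        x ^ s * ((SAW.stripSAWs (b + 1) a s (u + ![0, 1]) (v + ![0, 1])).card : ℝ)) := by
    rw [← sum_Abox, ENNReal.ofReal_sum_of_nonneg fun q _ => pow_nonneg hx _]
  apply le_antisymm
  · have h := ENNReal.tsum_comp_le_tsum_of_injective hf_inj
      fun q : ↥(Abox[a, b, u + ![0, 1], v + ![0, 1]]) => ENNReal.ofReal (x ^ q.1.length)
    rw [Finset.tsum_subtype _ fun q : (zdGraph 2).Walk (u + ![0, 1]) (v + ![0, 1]) =>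
      ENNReal.ofReal (x ^ q.length), hsum] at h
    refine le_trans (le_of_eq ?_) h
    rw [Zx]
    congr 1
    funext γ
    rw [length_eq_of_support (hf γ)]
    rfl
  · have h := ENNReal.tsum_comp_le_tsum_of_injective hg_inj
      fun γ : SAW.DomainSAW (rectDomain a b) 1 u v => ENNReal.ofReal (x ^ γ.length)
    rw [← hsum, ← Finset.tsum_subtype _ fun q : (zdGraph 2).Walk (u + ![0, 1]) (v + ![0, 1]) =>
      ENNReal.ofReal (x ^ q.length)]
    refine le_trans (le_of_eq ?_) h
    congr 1
    funext q
    show ENNReal.ofReal (x ^ q.1.length) = ENNReal.ofReal (x ^ (g q).walk.length)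
    rw [length_eq_of_support (hg q)]

/-! ## The witness -/

/-- `ofReal` of a strict product inequality between nonnegative reals. [folklore] -/
theorem ofReal_mul_lt_ofReal_mul {A B C D : ℝ} (hA : 0 ≤ A) (hB : 0 ≤ B) (hC : 0 ≤ C)
    (h : A * B < C * D) :
    ENNReal.ofReal A * ENNReal.ofReal B < ENNReal.ofReal C * ENNReal.ofReal D := by
  rw [← ENNReal.ofReal_mul hA, ← ENNReal.ofReal_mul hC,
    ENNReal.ofReal_lt_ofReal_iff (lt_of_le_of_lt (mul_nonneg hA hB) h)]
  exact h

/-- **S4 · rectangle plumbing.**  A strict corner violation "nested < crossing" in the box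
`{0..ℓ} × {1..W}` (`W ≥ 2`, `ℓ ≥ 1`, `x > 0`) at `TL = (0,W)`, `BL = (0,1)`, `BR = (ℓ,1)`,
`TR = (ℓ,W)` is a witness of the crux at `x`: `Ω` = the open rectangle
`(-1/2, ℓ+1/2) × (-1/2, W-1/2)` (bounded, convex hence simply connected; `Ω_1` = the grid
`{0..ℓ} × {0..W-1}` with lattice adjacency), `δ = 1`, `(p₁,p₂,p₃,p₄) = (TL, BL, BR, TR) - e₂`;
each `Zx` is `ofReal` of the corresponding real box sum (`Zx_rect_eq`), the interlacing
`(TL–BR | BL–TR)` is the rectangle-crossing lemma, and the pairings `(TL–BL | BR–TR)`,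
`(TL–TR | BL–BR)` are realised by the disjoint vertical, resp. horizontal, sides. [folklore] -/
theorem stub_rectanglePlumbing :
    ∀ (x : ℝ) (W ℓ : ℕ), 0 < x → 2 ≤ W → 1 ≤ ℓ →
      Zs[x, W, ℓ, ![0, (W : ℤ)], ![0, 1]] * Zs[x, W, ℓ, ![(ℓ : ℤ), 1], ![(ℓ : ℤ), (W : ℤ)]] <
        Zs[x, W, ℓ, ![0, (W : ℤ)], ![(ℓ : ℤ), 1]] * Zs[x, W, ℓ, ![0, 1], ![(ℓ : ℤ), (W : ℤ)]] →
      EdgeOfPositivityAt x := by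
  intro x W ℓ hx hW hℓ hlt
  obtain ⟨n, rfl⟩ : ∃ n, W = n + 1 := ⟨W - 1, by omega⟩
  -- the four shifted corners are grid sites
  have h1 : (![0, (n : ℤ)] : Site 2) ∈ rectSites ℓ n := by
    simp only [mem_rectSites_iff, Matrix.cons_val_zero, Matrix.cons_val_one]; omega
  have h2 : (![0, 0] : Site 2) ∈ rectSites ℓ n := by
    simp only [mem_rectSites_iff, Matrix.cons_val_zero, Matrix.cons_val_one]; omega
  have h3 : (![(ℓ : ℤ), 0] : Site 2) ∈ rectSites ℓ n := by
    simp only [mem_rectSites_iff, Matrix.cons_val_zero, Matrix.cons_val_one]; omega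
  -- shifting them up by `e₂` gives the corners of the box
  have e1 : (![0, ((n + 1 : ℕ) : ℤ)] : Site 2) = ![0, (n : ℤ)] + ![0, 1] := by
    ext i; fin_cases i <;> simp
  have e2 : (![0, 1] : Site 2) = ![0, 0] + ![0, 1] := by
    ext i; fin_cases i <;> simp
  have e3 : (![(ℓ : ℤ), 1] : Site 2) = ![(ℓ : ℤ), 0] + ![0, 1] := by
    ext i; fin_cases i <;> simp
  have e4 : (![(ℓ : ℤ), ((n + 1 : ℕ) : ℤ)] : Site 2) = ![(ℓ : ℤ), (n : ℤ)] + ![0, 1] := by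
    ext i; fin_cases i <;> simp
  have Z12 := Zx_rect_eq hx.le h1 e1 e2
  have Z34 := Zx_rect_eq hx.le h3 e3 e4
  have Z13 := Zx_rect_eq hx.le h1 e1 e3
  have Z24 := Zx_rect_eq hx.le h2 e2 e4
  refine ⟨rectDomain ℓ n, 1, ![0, (n : ℤ)], ![0, 0], ![(ℓ : ℤ), 0], ![(ℓ : ℤ), (n : ℤ)],
    isBounded_rectDomain ℓ n, simplyConnectedSpace_rectDomain ℓ n, one_pos, ?_, ?_, ?_, ?_⟩
  · -- interlacing: a left-right and a bottom-top crossing of the grid meet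
    intro P Q
    have hbox : ∀ {u v : Site 2} (hu : u ∈ rectSites ℓ n)
        (R : (discreteDomainGraph (rectDomain ℓ n) 1).Walk u v),
        ∀ z ∈ (R.mapLe (rect_le_zdGraph ℓ n)).support,
          (0 : ℤ) ≤ z 0 ∧ z 0 ≤ (ℓ : ℤ) ∧ (0 : ℤ) ≤ z 1 ∧ z 1 ≤ (n : ℤ) := by
      intro u v hu R z hz
      rw [Walk.support_mapLe_eq_support] at hz
      have h := support_subset_rectSites hu R z hz
      rw [mem_rectSites_iff] at h
      exact ⟨h.1.1, h.1.2, h.2.1, h.2.2⟩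
    obtain ⟨z, hzP, hzQ⟩ := exists_mem_support_of_crossing (L := 0) (R := (ℓ : ℤ)) (B := 0)
      (T := (n : ℤ)) (P.walk.mapLe (rect_le_zdGraph ℓ n)) (Q.walk.mapLe (rect_le_zdGraph ℓ n))
      (hbox h1 P.walk) (hbox h2 Q.walk) (by simp) (by simp) (by simp) (by simp)
    rw [Walk.support_mapLe_eq_support] at hzP hzQ
    exact ⟨z, hzP, hzQ⟩
  · -- (p₁p₂ | p₃p₄): the left side down, the right side up
    obtain ⟨P, hP, hPs⟩ := exists_colWalk (a := ℓ) (b := n) (i := 0) le_rfl (by omega) n le_rfl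
    obtain ⟨Q, hQ, hQs⟩ := exists_colWalk (a := ℓ) (b := n) (i := (ℓ : ℤ)) (by omega) le_rfl n le_rfl
    refine ⟨⟨P, hP⟩, ⟨Q.reverse, hQ.reverse⟩, fun w hwP hwQ => ?_⟩
    change w ∈ Q.reverse.support at hwQ
    rw [Walk.support_reverse, List.mem_reverse] at hwQ
    have hP0 := (hPs w hwP).1
    have hQ0 := (hQs w hwQ).1
    omega
  · -- (p₁p₄ | p₂p₃): the top side and the bottom side, left to right
    obtain ⟨P, hP, hPs⟩ := exists_rowWalk (a := ℓ) (b := n) (j := (n : ℤ)) (by omega) le_rfl ℓ le_rfl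
    obtain ⟨Q, hQ, hQs⟩ := exists_rowWalk (a := ℓ) (b := n) (j := 0) le_rfl (by omega) ℓ le_rfl
    refine ⟨⟨P.reverse, hP.reverse⟩, ⟨Q.reverse, hQ.reverse⟩, fun w hwP hwQ => ?_⟩
    change w ∈ P.reverse.support at hwP
    change w ∈ Q.reverse.support at hwQ
    rw [Walk.support_reverse, List.mem_reverse] at hwP hwQ
    have hP1 := (hPs w hwP).1
    have hQ1 := (hQs w hwQ).1
    omega
  · -- the strict TP₂ violation, transported (box sums are nonnegative, being sums of
    -- nonnegative terms)
    have hnn : ∀ a b : Site 2, 0 ≤ Zs[x, n + 1, ℓ, a, b] := fun a b =>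
      Finset.sum_nonneg fun s _ => mul_nonneg (pow_nonneg hx.le s) (Nat.cast_nonneg _)
    rw [Z12, Z34, Z13, Z24]
    exact ofReal_mul_lt_ofReal_mul (hnn _ _) (hnn _ _) (hnn _ _) hlt

end Summit.CriticalPhenomena.SAWScalingLimit.Theorems.EdgeOfPositivity.RectangleWindows.RectanglePlumbing

end
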